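import Mathlib
import Literature.Analysis.FluidPDE.TypeIICoreWitness
import Literature.Analysis.FluidPDE.VectorCalculus
import Literature.Analysis.FluidPDE.IsometryInvariance
import Literature.Analysis.Calculus.HadamardLemma
import Literature.Analysis.Calculus.CompactSupportDivergence
import Summits.NavierStokesRegularity.NavierStokesRegularity.Theorems.TypeIIInviscidRelaxationColumnarCoreExclusionAxialWindowAverage
import HarnessLib

/-!
# Crux `ColumnarCoreExclusion` (stmt-NavierStokesRegularity-1966), line `columnar_comparison_flow`:
# the divergence CORRECTOR of the axial window average — calculus of the window integral and an
# EXACTLY divergence-free, EXACTLY columnar corrected field (step R3a of the datum of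
# `stub_columnarComparisonFlow`)

`--supports stmt-NavierStokesRegularity-1966` (helper file; theorems only, no definitions, no `sorry`).

The registered construction stub `stub_columnarComparisonFlow` (line
`Cruxes/ColumnarCoreExclusion/Lines/columnar_comparison_flow.lean`) builds its comparison datum from the
axial window average `ḡ = (KL)⁻¹ A`, `A Y = ∫_{-h}^{h} g(Y + (τ − Y₂)e_z) dτ` (`h = KL/2`), of the core
slice `g` in witness coordinates (landed `C⁰` step: `ColumnarComparisonDatum.exists_columnar_axialWindowAverage_close`,
`2V/K`-close, exactly columnar) and then "corrects the `O(V/(K²L))` horizontal divergence".  This file does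
that correction EXACTLY and globally on `ℝ³`, with no definitions (the objects enter through defining
equations `hA`, `hD`, `hC`):

* §1 calculus of the axial sample map: smoothness of `Y ↦ ∫_a^b g(Y + (τ − Y₂)e_z) dτ`
  (`contDiff_axialWindowIntegral`, via the tree's `contDiff_intervalIntegral`), the fundamental theorem of
  calculus along the axis (`integral_fderiv_axial_eq_sub`), and the Leibniz rule in a horizontal direction
  (`hasDerivAt_axialWindowIntegral_horizontal`, via the tree's `hasFDerivAt_intervalIntegral_partialFDerivFst`);
* §2 `div v = (Dv e₀)₀ + (Dv e₁)₁ + (Dv e_z)₂` and components of directional derivatives as derivatives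
  along lines;
* §3 the corrected field `F = A + C e₁`, where `D Y = g(Y + (h − Y₂)e_z)₂ − g(Y + (−h − Y₂)e_z)₂` is the
  axial flux defect through the window ends and `C Y = ∫_0^{Y₁} D(Y + (s − Y₁)e₁) ds` its primitive along
  `e₁`: `A`, `D`, `C` are columnar and smooth, `∂₁C = D` (`hasDerivAt_corrector_e1`), and
  **`div F = 0` on all of `ℝ³`** (`isDivFree_corrected`): `∂₀A₀ + ∂₁A₁ = ∫(∂₀g₀ + ∂₁g₁) = −∫∂_z g₂ = −D`
  by `div g = 0` and the fundamental theorem along the window, `∂₁(C e₁)₁ = D`, `∂₂F₂ = 0` by columnarity.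

The size estimates (`|D| ≤ 2V/K` and `(KL)⁻¹|C| ≤ V/K` on the half ball, hence `3V/K`-closeness of
`(KL)⁻¹F` to `g`) and the statement in the stub's physical coordinates are the sequel file
`…ColumnarCoreExclusionDivFreeDatum`.  WHAT THIS IS NOT: the cut-off / extension outside the half ball, the
global 2½-dimensional launch (2D Navier–Stokes on `𝕋²` is in the tree, `Torus.exists_classicalNS_forced_fin_two`;
the passive-scalar vertical component and the columnar lift are not), the shadowing stub.  Nothing here
closes a stub, the crux, or says anything about Navier–Stokes regularity.
-/

noncomputable section

open Literature.Analysis.FluidPDE Literature.Analysis.Calculus Set Metric MeasureTheory Real Function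
open scoped RealInnerProductSpace ContDiff

namespace Summit.NavierStokesRegularity.NavierStokesRegularity.Theorems

-- the problem directory repeats the summit name (`NavierStokesRegularity/NavierStokesRegularity`)
set_option linter.dupNamespace false

namespace ColumnarComparisonDatum

/-! ## §1 Calculus of the axial sample map `(Y, τ) ↦ Y + (τ − Y₂) e_z` -/

/-- The axial sample map `(Y, τ) ↦ Y + (τ − Y₂) e_z` is smooth jointly. [folklore] -/
theorem contDiff_axialSampleMap :
    ContDiff ℝ ∞ fun p : EuclideanSpace ℝ (Fin 3) × ℝ => p.1 + (p.2 - p.1 2) • eZ := by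
  have h2 : ContDiff ℝ ∞ fun p : EuclideanSpace ℝ (Fin 3) × ℝ => p.1 2 :=
    contDiff_euclidean.1 contDiff_fst (2 : Fin 3)
  exact contDiff_fst.add ((contDiff_snd.sub h2).smul contDiff_const)

/-- The axial window integral `Y ↦ ∫_a^b g(Y + (τ − Y₂)e_z) dτ` of a smooth field is smooth
(differentiation under the integral sign, `contDiff_intervalIntegral`). [folklore] -/
theorem contDiff_axialWindowIntegral {F : Type*} [NormedAddCommGroup F] [NormedSpace ℝ F]
    [CompleteSpace F] {g : EuclideanSpace ℝ (Fin 3) → F} (hg : ContDiff ℝ ∞ g) (a b : ℝ) :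
    ContDiff ℝ ∞ fun Y : EuclideanSpace ℝ (Fin 3) => ∫ τ in a..b, g (Y + (τ - Y 2) • eZ) :=
  contDiff_intervalIntegral (F := fun Y τ => g (Y + (τ - Y 2) • eZ)) (hg.comp contDiff_axialSampleMap) a b

/-- Along the axis the sample path `τ ↦ Y + (τ − Y₂) e_z` has velocity `e_z`. [folklore] -/
theorem hasDerivAt_axialSamplePath (Y : EuclideanSpace ℝ (Fin 3)) (τ : ℝ) :
    HasDerivAt (fun σ : ℝ => Y + (σ - Y 2) • eZ) eZ τ := by
  have h := (((hasDerivAt_id τ).sub_const (Y 2)).smul_const eZ).const_add Y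
  simpa using h

/-- **Fundamental theorem of calculus along the axis**: for a `C¹` field `g`,
`∫_a^b Dg(Y + (τ − Y₂)e_z) e_z dτ = g(Y + (b − Y₂)e_z) − g(Y + (a − Y₂)e_z)`. [folklore] -/
theorem integral_fderiv_axial_eq_sub {F : Type*} [NormedAddCommGroup F] [NormedSpace ℝ F]
    [CompleteSpace F] {g : EuclideanSpace ℝ (Fin 3) → F} (hg : ContDiff ℝ 1 g)
    (Y : EuclideanSpace ℝ (Fin 3)) (a b : ℝ) :
    ∫ τ in a..b, fderiv ℝ g (Y + (τ - Y 2) • eZ) eZ =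
      g (Y + (b - Y 2) • eZ) - g (Y + (a - Y 2) • eZ) := by
  have hd : ∀ τ : ℝ, HasDerivAt (fun σ : ℝ => g (Y + (σ - Y 2) • eZ))
      (fderiv ℝ g (Y + (τ - Y 2) • eZ) eZ) τ := fun τ =>
    ((hg.differentiable one_ne_zero) _).hasFDerivAt.comp_hasDerivAt τ (hasDerivAt_axialSamplePath Y τ)
  have hc : Continuous fun τ : ℝ => fderiv ℝ g (Y + (τ - Y 2) • eZ) eZ :=
    ((hg.continuous_fderiv one_ne_zero).comp
      (continuous_const.add ((continuous_id.sub continuous_const).smul continuous_const))).clm_apply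
      continuous_const
  exact intervalIntegral.integral_eq_sub_of_hasDerivAt (fun τ _ => hd τ) (hc.intervalIntegrable _ _)

/-- **Differentiation of the axial window integral in a horizontal direction** (`v₂ = 0`, so the
window does not move): `ε ↦ ∫_a^b g((Y + εv) + (τ − (Y + εv)₂)e_z) dτ` has derivative
`∫_a^b Dg(Y + (τ − Y₂)e_z) v dτ` at `ε = 0` (Leibniz rule, `hasFDerivAt_intervalIntegral_partialFDerivFst`).
[folklore] -/
theorem hasDerivAt_axialWindowIntegral_horizontal {g : EuclideanSpace ℝ (Fin 3) → EuclideanSpace ℝ (Fin 3)}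
    (hg : ContDiff ℝ ∞ g) (Y v : EuclideanSpace ℝ (Fin 3)) (hv : v 2 = 0) (a b : ℝ) :
    HasDerivAt (fun ε : ℝ => ∫ τ in a..b, g ((Y + ε • v) + (τ - (Y + ε • v) 2) • eZ))
      (∫ τ in a..b, fderiv ℝ g (Y + (τ - Y 2) • eZ) v) 0 := by
  -- the window does not move: rewrite the sample points as `Y + (τ - Y₂)e_z + ε v`
  have hpt : ∀ (ε τ : ℝ), (Y + ε • v) + (τ - (Y + ε • v) 2) • eZ = (Y + (τ - Y 2) • eZ) + ε • v := by
    intro ε τ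
    have : (Y + ε • v) 2 = Y 2 := by simp [hv]
    rw [this]; abel
  simp_rw [hpt]
  set F : ℝ → ℝ → EuclideanSpace ℝ (Fin 3) := fun ε τ => g ((Y + (τ - Y 2) • eZ) + ε • v) with hF_def
  have hF : ContDiff ℝ ∞ (uncurry F) := by
    have hA : ContDiff ℝ ∞ fun p : ℝ × ℝ => (Y + (p.2 - Y 2) • eZ) + p.1 • v :=
      (contDiff_const.add ((contDiff_snd.sub contDiff_const).smul contDiff_const)).add
        (contDiff_fst.smul contDiff_const)
    exact hg.comp hA
  have h1 : HasFDerivAt (fun ε => ∫ τ in a..b, F ε τ) (∫ τ in a..b, partialFDerivFst F 0 τ) 0 :=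
    hasFDerivAt_intervalIntegral_partialFDerivFst hF (by simp) a b 0
  have h2 : HasDerivAt (fun ε => ∫ τ in a..b, F ε τ) ((∫ τ in a..b, partialFDerivFst F 0 τ) 1) 0 :=
    h1.hasDerivAt
  have hint : IntervalIntegrable (fun τ => partialFDerivFst F 0 τ) volume a b :=
    ((continuous_uncurry_partialFDerivFst hF (by simp)).comp
      (Continuous.prodMk_right (0 : ℝ))).intervalIntegrable _ _
  rw [ContinuousLinearMap.intervalIntegral_apply hint] at h2
  -- identify `∂_ε F (0, τ) 1 = Dg(Y + (τ - Y₂)e_z) v`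
  have hid : ∀ τ : ℝ, partialFDerivFst F 0 τ 1 = fderiv ℝ g (Y + (τ - Y 2) • eZ) v := by
    intro τ
    have hline : HasDerivAt (fun ε : ℝ => (Y + (τ - Y 2) • eZ) + ε • v) v 0 := by
      simpa using ((hasDerivAt_id (0 : ℝ)).smul_const v).const_add (Y + (τ - Y 2) • eZ)
    have hchain : HasDerivAt (fun ε : ℝ => g ((Y + (τ - Y 2) • eZ) + ε • v))
        (fderiv ℝ g (Y + (τ - Y 2) • eZ) v) 0 := by
      have hg' : HasFDerivAt g (fderiv ℝ g ((Y + (τ - Y 2) • eZ) + (0 : ℝ) • v))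
          ((Y + (τ - Y 2) • eZ) + (0 : ℝ) • v) :=
        ((hg.differentiable (by simp)) _).hasFDerivAt
      have := hg'.comp_hasDerivAt (0 : ℝ) hline
      simpa [Function.comp_def] using this
    have hpart : HasDerivAt (fun ε : ℝ => F ε τ) (partialFDerivFst F 0 τ 1) 0 :=
      (hasFDerivAt_partialFDerivFst ((hF.differentiable (by simp)).differentiableAt)).hasDerivAt
    exact hpart.unique hchain
  simp_rw [hid] at h2
  exact h2

/-! ## §2 The divergence in coordinates -/

/-- `div v (x) = (Dv(x) e₀)₀ + (Dv(x) e₁)₁ + (Dv(x) e_z)₂` on `ℝ³` (trace over the standard basis).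
[folklore] -/
theorem divergence_eq_sum_three (v : EuclideanSpace ℝ (Fin 3) → EuclideanSpace ℝ (Fin 3))
    (x : EuclideanSpace ℝ (Fin 3)) :
    VectorCalculus.divergence v x =
      fderiv ℝ v x (EuclideanSpace.single 0 1) 0 + fderiv ℝ v x (EuclideanSpace.single 1 1) 1 +
        fderiv ℝ v x eZ 2 := by
  rw [divergence_eq_sum_inner_fderiv (EuclideanSpace.basisFun (Fin 3) ℝ), Fin.sum_univ_three]
  simp [EuclideanSpace.basisFun_apply, EuclideanSpace.inner_single_left, eZ]

/-- A component of a directional derivative is the derivative of that component along the line: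
if `F` is differentiable at `Y` then `ε ↦ F(Y + εv)ᵢ` has derivative `(DF(Y) v)ᵢ` at `0`. [folklore] -/
theorem hasDerivAt_apply_line {F : EuclideanSpace ℝ (Fin 3) → EuclideanSpace ℝ (Fin 3)}
    {Y : EuclideanSpace ℝ (Fin 3)} (hF : DifferentiableAt ℝ F Y) (v : EuclideanSpace ℝ (Fin 3)) (i : Fin 3) :
    HasDerivAt (fun ε : ℝ => F (Y + ε • v) i) (fderiv ℝ F Y v i) 0 := by
  have hline : HasDerivAt (fun ε : ℝ => Y + ε • v) v 0 := by
    simpa using ((hasDerivAt_id (0 : ℝ)).smul_const v).const_add Y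
  have hF' : HasFDerivAt F (fderiv ℝ F (Y + (0 : ℝ) • v)) (Y + (0 : ℝ) • v) := by
    simpa using hF.hasFDerivAt
  have h1 : HasDerivAt (fun ε : ℝ => F (Y + ε • v)) (fderiv ℝ F Y v) 0 := by
    have := hF'.comp_hasDerivAt (0 : ℝ) hline
    simpa [Function.comp_def] using this
  have h2 := (EuclideanSpace.proj i).hasFDerivAt.comp_hasDerivAt (0 : ℝ) h1
  simpa [Function.comp_def] using h2

/-! ## §3 The divergence-corrected axial window average (witness coordinates)

Throughout, `g` is the core slice in witness coordinates, `h = KL/2` the half window,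
`A Y = ∫_{-h}^{h} g(Y + (τ − Y₂)e_z) dτ` the (unnormalised) axial window integral,
`D Y = g(Y + (h − Y₂)e_z)₂ − g(Y + (−h − Y₂)e_z)₂` the axial flux defect through the window ends, and
`C Y = ∫_0^{Y₁} D(Y + (s − Y₁)e₁) ds` its primitive in the `e₁` direction; the corrected field is
`w = (2h)⁻¹ (A + C e₁)`.  All three are introduced by defining equations (no definitions in this file). -/

section Corrected

variable {g : EuclideanSpace ℝ (Fin 3) → EuclideanSpace ℝ (Fin 3)} {h : ℝ}
  {A : EuclideanSpace ℝ (Fin 3) → EuclideanSpace ℝ (Fin 3)} {D C : EuclideanSpace ℝ (Fin 3) → ℝ}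

/-- The axial window integral is columnar: the sample points of `Y + σ e_z` and of `Y` coincide.
[folklore] -/
theorem columnar_windowIntegral (hA : A = fun Y => ∫ τ in (-h)..h, g (Y + (τ - Y 2) • eZ))
    (Y : EuclideanSpace ℝ (Fin 3)) (σ : ℝ) : A (Y + σ • eZ) = A Y := by
  rw [hA]
  dsimp only
  refine intervalIntegral.integral_congr fun τ _ => ?_
  rw [add_smul_eZ_apply_two, add_assoc, ← add_smul]
  congr 3
  ring

/-- The axial flux defect is columnar. [folklore] -/
theorem columnar_fluxDefect
    (hD : D = fun Y => g (Y + (h - Y 2) • eZ) 2 - g (Y + (-h - Y 2) • eZ) 2)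
    (Y : EuclideanSpace ℝ (Fin 3)) (σ : ℝ) : D (Y + σ • eZ) = D Y := by
  rw [hD]
  dsimp only
  have e : ∀ c : ℝ, Y + σ • eZ + (c - (Y + σ • eZ) 2) • eZ = Y + (c - Y 2) • eZ := by
    intro c
    rw [add_smul_eZ_apply_two, add_assoc, ← add_smul, show σ + (c - (Y 2 + σ)) = c - Y 2 by ring]
  rw [e, e]

/-- The corrector is columnar. [folklore] -/
theorem columnar_corrector
    (hD : D = fun Y => g (Y + (h - Y 2) • eZ) 2 - g (Y + (-h - Y 2) • eZ) 2)
    (hC : C = fun Y => ∫ s in (0 : ℝ)..(Y 1), D (Y + (s - Y 1) • EuclideanSpace.single 1 1))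
    (Y : EuclideanSpace ℝ (Fin 3)) (σ : ℝ) : C (Y + σ • eZ) = C Y := by
  rw [hC]
  dsimp only
  rw [add_smul_eZ_apply_one]
  refine intervalIntegral.integral_congr fun s _ => ?_
  have e : Y + σ • eZ + (s - Y 1) • EuclideanSpace.single 1 1 =
      (Y + (s - Y 1) • EuclideanSpace.single 1 1) + σ • eZ := by abel
  rw [e, columnar_fluxDefect hD]

/-- The axial flux defect of a smooth field is smooth. [folklore] -/
theorem contDiff_fluxDefect (hg : ContDiff ℝ ∞ g)
    (hD : D = fun Y => g (Y + (h - Y 2) • eZ) 2 - g (Y + (-h - Y 2) • eZ) 2) : ContDiff ℝ ∞ D := by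
  have hend : ∀ c : ℝ, ContDiff ℝ ∞ fun Y : EuclideanSpace ℝ (Fin 3) => Y + (c - Y 2) • eZ := fun c => by
    have hs : ContDiff ℝ ∞ fun Y : EuclideanSpace ℝ (Fin 3) => c - Y 2 :=
      contDiff_const.sub (contDiff_euclidean.1 contDiff_id (2 : Fin 3))
    exact contDiff_id.add (hs.smul contDiff_const)
  rw [hD]
  exact (contDiff_euclidean.1 (hg.comp (hend h)) (2 : Fin 3)).sub
    (contDiff_euclidean.1 (hg.comp (hend (-h))) (2 : Fin 3))

/-- The corrector of a smooth field is smooth (a primitive with variable upper limit and parameters,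
`contDiff_parametric_primitive_of_contDiff`). [folklore] -/
theorem contDiff_corrector (hg : ContDiff ℝ ∞ g)
    (hD : D = fun Y => g (Y + (h - Y 2) • eZ) 2 - g (Y + (-h - Y 2) • eZ) 2)
    (hC : C = fun Y => ∫ s in (0 : ℝ)..(Y 1), D (Y + (s - Y 1) • EuclideanSpace.single 1 1)) :
    ContDiff ℝ ∞ C := by
  have hDs := contDiff_fluxDefect hg hD
  have hs : ContDiff ℝ ∞ fun q : ℝ × EuclideanSpace ℝ (Fin 3) => q.1 - q.2 1 :=
    contDiff_fst.sub (contDiff_euclidean.1 contDiff_snd (1 : Fin 3))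
  have hH : ContDiff ℝ ∞ fun q : ℝ × EuclideanSpace ℝ (Fin 3) =>
      D (q.2 + (q.1 - q.2 1) • EuclideanSpace.single 1 1) :=
    hDs.comp (contDiff_snd.add (hs.smul contDiff_const))
  have hΦ := contDiff_parametric_primitive_of_contDiff
    (h := fun q : ℝ × EuclideanSpace ℝ (Fin 3) => D (q.2 + (q.1 - q.2 1) • EuclideanSpace.single 1 1)) hH 0
  have hι : ContDiff ℝ ∞ fun Y : EuclideanSpace ℝ (Fin 3) => ((Y 1, Y) : ℝ × EuclideanSpace ℝ (Fin 3)) :=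
    (contDiff_euclidean.1 contDiff_id (1 : Fin 3)).prodMk contDiff_id
  rw [hC]
  exact hΦ.comp hι

/-- **Derivative of the corrector in the `e₁` direction**: `∂₁ C = D` (fundamental theorem of calculus;
moving `Y` along `e₁` only moves the upper limit). [folklore] -/
theorem hasDerivAt_corrector_e1 (hg : ContDiff ℝ ∞ g)
    (hD : D = fun Y => g (Y + (h - Y 2) • eZ) 2 - g (Y + (-h - Y 2) • eZ) 2)
    (hC : C = fun Y => ∫ s in (0 : ℝ)..(Y 1), D (Y + (s - Y 1) • EuclideanSpace.single 1 1))
    (Y : EuclideanSpace ℝ (Fin 3)) :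
    HasDerivAt (fun ε : ℝ => C (Y + ε • EuclideanSpace.single 1 1)) (D Y) 0 := by
  have hDc : Continuous D := (contDiff_fluxDefect hg hD).continuous
  -- along `e₁` only the upper limit moves
  have hre : (fun ε : ℝ => C (Y + ε • EuclideanSpace.single 1 1)) =
      fun ε : ℝ => ∫ s in (0 : ℝ)..(Y 1 + ε), D (Y + (s - Y 1) • EuclideanSpace.single 1 1) := by
    funext ε
    rw [hC]
    dsimp only
    have h1 : (Y + ε • EuclideanSpace.single (1 : Fin 3) (1 : ℝ)) 1 = Y 1 + ε := by
      simp
    rw [h1]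
    refine intervalIntegral.integral_congr fun s _ => ?_
    dsimp only
    rw [add_assoc, ← add_smul]
    congr 3
    ring
  rw [hre]
  have hG : ∀ r : ℝ, HasDerivAt (fun r : ℝ => ∫ s in (0 : ℝ)..r, D (Y + (s - Y 1) • EuclideanSpace.single 1 1))
      (D (Y + (r - Y 1) • EuclideanSpace.single 1 1)) r := by
    intro r
    have hc : Continuous fun s : ℝ => D (Y + (s - Y 1) • EuclideanSpace.single 1 1) :=
      hDc.comp (continuous_const.add ((continuous_id.sub continuous_const).smul continuous_const))
    exact intervalIntegral.integral_hasDerivAt_right (hc.intervalIntegrable _ _)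
      (hc.stronglyMeasurableAtFilter _ _) hc.continuousAt
  have := (hG (Y 1 + 0)).comp_const_add (Y 1) 0
  simpa using this

/-- **The corrected field is divergence free.**  For a smooth divergence-free `g`, the field
`F = A + C e₁` satisfies `div F = 0`: `∂₀A₀ + ∂₁A₁ = ∫ (∂₀g₀ + ∂₁g₁) = −∫ ∂_z g₂ = −D` along the window
(Leibniz rule, `div g = 0`, fundamental theorem of calculus), `∂₁(C) = D`, and `∂₂F₂ = 0` by
columnarity. [folklore] -/
theorem isDivFree_corrected (hg : ContDiff ℝ ∞ g) (hdiv : VectorCalculus.IsDivFree g)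
    (hA : A = fun Y => ∫ τ in (-h)..h, g (Y + (τ - Y 2) • eZ))
    (hD : D = fun Y => g (Y + (h - Y 2) • eZ) 2 - g (Y + (-h - Y 2) • eZ) 2)
    (hC : C = fun Y => ∫ s in (0 : ℝ)..(Y 1), D (Y + (s - Y 1) • EuclideanSpace.single 1 1)) :
    VectorCalculus.IsDivFree fun Y => A Y + C Y • EuclideanSpace.single 1 1 := by
  intro Y
  set F : EuclideanSpace ℝ (Fin 3) → EuclideanSpace ℝ (Fin 3) :=
    fun Y => A Y + C Y • EuclideanSpace.single 1 1 with hF_def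
  have hAs : ContDiff ℝ ∞ A := by rw [hA]; exact contDiff_axialWindowIntegral hg _ _
  have hCs : ContDiff ℝ ∞ C := contDiff_corrector hg hD hC
  have hFs : ContDiff ℝ ∞ F := hAs.add (hCs.smul contDiff_const)
  have hFd : DifferentiableAt ℝ F Y := (hFs.differentiable (by simp)) Y
  -- the three diagonal entries of `DF(Y)` as derivatives along lines
  have h0 := hasDerivAt_apply_line hFd (EuclideanSpace.single 0 1) 0
  have h1 := hasDerivAt_apply_line hFd (EuclideanSpace.single 1 1) 1
  have h2 := hasDerivAt_apply_line hFd eZ 2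
  -- `e_z`: columnarity
  have hcolF : ∀ ε : ℝ, F (Y + ε • eZ) = F Y := fun ε => by
    simp only [hF_def, columnar_windowIntegral hA, columnar_corrector hD hC]
  have h2' : HasDerivAt (fun ε : ℝ => F (Y + ε • eZ) 2) 0 0 := by
    simp_rw [hcolF]; exact hasDerivAt_const _ _
  have d2 : fderiv ℝ F Y eZ 2 = 0 := h2.unique h2'
  -- `e₀`: only the window integral contributes
  have hA0 : HasDerivAt (fun ε : ℝ => A (Y + ε • EuclideanSpace.single 0 1))
      (∫ τ in (-h)..h, fderiv ℝ g (Y + (τ - Y 2) • eZ) (EuclideanSpace.single 0 1)) 0 := by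
    rw [hA]; exact hasDerivAt_axialWindowIntegral_horizontal hg Y _ (by simp) _ _
  have hA1 : HasDerivAt (fun ε : ℝ => A (Y + ε • EuclideanSpace.single 1 1))
      (∫ τ in (-h)..h, fderiv ℝ g (Y + (τ - Y 2) • eZ) (EuclideanSpace.single 1 1)) 0 := by
    rw [hA]; exact hasDerivAt_axialWindowIntegral_horizontal hg Y _ (by simp) _ _
  have h0' : HasDerivAt (fun ε : ℝ => F (Y + ε • EuclideanSpace.single 0 1) 0)
      ((∫ τ in (-h)..h, fderiv ℝ g (Y + (τ - Y 2) • eZ) (EuclideanSpace.single 0 1)) 0) 0 := by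
    have e : (fun ε : ℝ => F (Y + ε • EuclideanSpace.single 0 1) 0) =
        fun ε : ℝ => A (Y + ε • EuclideanSpace.single 0 1) 0 := by
      funext ε; simp [hF_def]
    rw [e]
    have := (EuclideanSpace.proj (0 : Fin 3)).hasFDerivAt.comp_hasDerivAt (0 : ℝ) hA0
    simpa [Function.comp_def] using this
  have h1' : HasDerivAt (fun ε : ℝ => F (Y + ε • EuclideanSpace.single 1 1) 1)
      ((∫ τ in (-h)..h, fderiv ℝ g (Y + (τ - Y 2) • eZ) (EuclideanSpace.single 1 1)) 1 + D Y) 0 := by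
    have e : (fun ε : ℝ => F (Y + ε • EuclideanSpace.single 1 1) 1) =
        fun ε : ℝ => A (Y + ε • EuclideanSpace.single 1 1) 1 + C (Y + ε • EuclideanSpace.single 1 1) := by
      funext ε; simp [hF_def]
    rw [e]
    have := (EuclideanSpace.proj (1 : Fin 3)).hasFDerivAt.comp_hasDerivAt (0 : ℝ) hA1
    have hA1' : HasDerivAt (fun ε : ℝ => A (Y + ε • EuclideanSpace.single 1 1) 1)
        ((∫ τ in (-h)..h, fderiv ℝ g (Y + (τ - Y 2) • eZ) (EuclideanSpace.single 1 1)) 1) 0 := by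
      simpa [Function.comp_def] using this
    exact hA1'.add (hasDerivAt_corrector_e1 hg hD hC Y)
  have d0 := h0.unique h0'
  have d1 := h1.unique h1'
  -- assemble
  rw [divergence_eq_sum_three, d0, d1, d2]
  -- components of the integrals are integrals of components
  have hcont : ∀ v : EuclideanSpace ℝ (Fin 3), Continuous fun τ : ℝ => fderiv ℝ g (Y + (τ - Y 2) • eZ) v :=
    fun v => ((hg.continuous_fderiv (by simp)).comp
      (continuous_const.add ((continuous_id.sub continuous_const).smul continuous_const))).clm_apply
      continuous_const
  have hcomp : ∀ (v : EuclideanSpace ℝ (Fin 3)) (i : Fin 3),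
      (∫ τ in (-h)..h, fderiv ℝ g (Y + (τ - Y 2) • eZ) v) i =
        ∫ τ in (-h)..h, fderiv ℝ g (Y + (τ - Y 2) • eZ) v i := by
    intro v i
    have := ((EuclideanSpace.proj i).intervalIntegral_comp_comm
      ((hcont v).intervalIntegrable (μ := volume) (-h) h)).symm
    simpa using this
  rw [hcomp, hcomp]
  -- `div g = 0` pointwise along the window
  have hpt : ∀ τ : ℝ, fderiv ℝ g (Y + (τ - Y 2) • eZ) (EuclideanSpace.single 0 1) 0 +
      fderiv ℝ g (Y + (τ - Y 2) • eZ) (EuclideanSpace.single 1 1) 1 =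
        -(fderiv ℝ g (Y + (τ - Y 2) • eZ) eZ 2) := by
    intro τ
    have := hdiv (Y + (τ - Y 2) • eZ)
    rw [divergence_eq_sum_three] at this
    linarith
  have hi0 : IntervalIntegrable (fun τ : ℝ => fderiv ℝ g (Y + (τ - Y 2) • eZ) (EuclideanSpace.single 0 1) 0)
      volume (-h) h :=
    ((PiLp.continuous_apply 2 (fun _ : Fin 3 => ℝ) (0 : Fin 3)).comp (hcont _)).intervalIntegrable _ _
  have hi1 : IntervalIntegrable (fun τ : ℝ => fderiv ℝ g (Y + (τ - Y 2) • eZ) (EuclideanSpace.single 1 1) 1)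
      volume (-h) h :=
    ((PiLp.continuous_apply 2 (fun _ : Fin 3 => ℝ) (1 : Fin 3)).comp (hcont _)).intervalIntegrable _ _
  rw [add_zero, ← add_assoc, ← intervalIntegral.integral_add hi0 hi1]
  simp_rw [hpt]
  rw [intervalIntegral.integral_neg, ← hcomp, integral_fderiv_axial_eq_sub (hg.of_le (mod_cast le_top))]
  simp [hD]

end Corrected


end ColumnarComparisonDatum

end Summit.NavierStokesRegularity.NavierStokesRegularity.Theorems

end
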